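import Summits.AtomisticToContinuum.Crystallization.Theorems.ThreeConeCertificateSlackRigidityPricedFloorsReduction
import HarnessLib

/-!
# `SlackRigidity` (stmt-AtomisticToContinuum-11960), line `priced-floors-palm-exactification`:
# the WEAKEST one-scale residual — `FiniteLayerRigidity` — and the `LayerFloor` chain

Lead c21.  In the landed reduction
`SlackRigidityPricedFloorsReduction.lms_slackRigidity_of_pricedInequalities :
CoerciveTwoShellGap → NearFieldConvexity → SlackRigidity` (p151540) the two priced inequalities of route
`PhononSlackCertificates` (items 13956, 13958) are consumed ONLY by the floors-application step
(`SlackRigidityPricedFloorsApplication.stub_floorsApplication`), and what that step uses of them is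
strictly less than the pair.  This file isolates the weakest finite-volume, one-scale statement the
landed Palm machinery needs and proves the whole chain

  `CoerciveTwoShellGap → NearFieldConvexity → LayerFloor → FiniteLayerRigidity → floors application
   → PalmRigidity (item 9224) → SlackRigidity (this crux)`,

every arrow a theorem of this file or already landed:

* **`FiniteLayerRigidity`** (qualitative, one scale, selector-free): for all `δ, η, b > 0` there are
  `τ > 0` and `M` such that every `δ`-separated configuration of `N ≥ M` points with
  `𝓔(x) ≤ N e* + τ N` has at most `b N` points that are not `η`-layered at radius `2`
  (`LayeredAt 2 2 η`, the layered family of item 13958);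
* **`LayerFloor`** (the strategist's `S⁺₆`, `Cruxes/SlackRigidity/STRATEGY-CENSUS.md`): for all
  `δ, η > 0` there is `κ > 0` with `N e* + κ #{i not η-layered} ≤ 𝓔(x)` for every `δ`-separated `x`;
* `lms_layerFloor_of_pricedInequalities` — items 13956 ∧ 13958 ⇒ `LayerFloor` (the finite-`N`
  bookkeeping of `SlackRigidityPricedFloorsApplication.core`: few bad particles, site floor on the bad
  ones, the `4`-boundary of the good set charged to the bad particles by the fibre count);
* `lms_finiteLayerRigidity_of_layerFloor` — `τ = κ b`;
* `lms_floorsApplication_of_finiteLayerRigidity` — the conclusion of `stub_floorsApplication` from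
  `FiniteLayerRigidity` alone (selection at deepness radius `2`, slack `τ`, size `max M 1`; a deep point
  whose re-rooted sample misses `G` is not `η`-layered in the cluster, by locality);
* `lms_palmRigidity_of_finiteLayerRigidity`, `lms_slackRigidity_of_finiteLayerRigidity`,
  `lms_slackRigidity_of_layerFloor` — the compositions with the six LANDED stubs of the line.

So the crux is closed modulo ANY ONE of: items 13956 ∧ 13958 (filed), `LayerFloor`, or
`FiniteLayerRigidity`; the crux's dependence on the particular typing of the PhononSlack items
(tolerances `1/20`, `47/50`, boundary radius `4`, the two-shell selector) is not load-bearing.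
All `[folklore]` bookkeeping.
-/

noncomputable section

open MeasureTheory Filter Set
open scoped ENNReal BigOperators Topology

namespace Summit.AtomisticToContinuum.Crystallization.Theorems.SlackRigidityPricedFloorsLayerFloor

open Literature.Probability.Process
open Literature.MathematicalPhysics.StatisticalMechanics
open Literature.Geometry.DiscreteGeometry
open Summit.AtomisticToContinuum.Crystallization.Theses.ThreeConeCertificate (SlackRigidity)
open Summit.AtomisticToContinuum.Crystallization.Theses.PalmUnimodularRigidity (PalmRigidity)
open Summit.AtomisticToContinuum.Crystallization.Theses.PhononSlackCertificates
  (CoerciveTwoShellGap NearFieldConvexity)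
open Summit.AtomisticToContinuum.Crystallization.Theorems
open Summit.AtomisticToContinuum.Crystallization.Theorems.MinimiserShells.Negative.LoadBearing (eStar)
open Summit.AtomisticToContinuum.Crystallization.Theorems.SlackRigidityPricedFloors
open Summit.AtomisticToContinuum.Crystallization.Theorems.SlackRigidityPricedFloorsApplication
  (natCard_mono natCard_le_add layeredAt_of_local isRootedHardCore_reroot half_site_ge coercive_eStar
    convexity_layered)
open Summit.AtomisticToContinuum.Crystallization.Theorems.PhononSlackCertificatesNearFarGlueR
  (glue_sum_univ_half_site_sub stub_fibre)

/-! ## From `FiniteLayerRigidity` to the floors application -/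

/-- **Registered sub-goal `lms_floorsApplication_of_finiteLayerRigidity`**: the conclusion of the line's
`stub_floorsApplication` — every measurable event containing the `η`-layered-root event has full
probability under a minimising point-stationary hard-core law with cluster selection — from
`FiniteLayerRigidity` ALONE (no priced inequality, no two-shell selector). [folklore] -/
theorem lms_floorsApplication_of_finiteLayerRigidity : (∀ δ : ℝ, 0 < δ → ∀ η : ℝ, 0 < η → ∀ b : ℝ, 0 < b → ∃ τ : ℝ, 0 < τ ∧ ∃ M : ℕ, ∀ (N : ℕ) (x : Fin N → E3), M ≤ N → (∀ i j : Fin N, i ≠ j → δ ≤ dist (x i) (x j)) → interactionEnergy lennardJones x ≤ (N : ℝ) * eStar + τ * N → (Nat.card {i : Fin N // ¬ LayeredAt 2 2 η (Set.range x) (x i)} : ℝ) ≤ b * N) → ∀ δ : ℝ, 0 < δ → ∀ P : Measure (Measure E3), IsProbabilityMeasure P → IsMinimisingLaw δ P → (∀ G : Set (Measure E3), MeasurableSet G → P Gᶜ ≠ 0 → ClusterSelectionFor δ G) → ∀ η : ℝ, 0 < η → ∀ G : Set (Measure E3), MeasurableSet G → (∀ μ : Measure E3, IsRootedHardCore δ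 μ → LayeredAt 2 2 η (atoms μ) 0 → μ ∈ G) → P Gᶜ = 0 := by
  intro hflr δ hδ P _ _ hsel η hη G hG hGL
  classical
  by_contra hne
  obtain ⟨b, hb, hS⟩ := hsel G hG hne
  obtain ⟨τ, hτ, M, hM⟩ := hflr δ hδ η hη (b / 2) (by positivity)
  -- the selected cluster: deepness radius `2`, slack `τ`, size `≥ max M 1`
  obtain ⟨S, T, hsep, hTS, hTM, hE, hD⟩ := hS 2 τ (max M 1) hτ
  -- the `Fin #T`-indexing of the cluster
  set x : Fin T.card → E3 := fun i => ((T.equivFin.symm i : T) : E3) with hx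
  have hxi : ∀ i, x i = ((T.equivFin.symm i : T) : E3) := fun i => by rw [hx]
  have hxT : ∀ i, x i ∈ T := fun i => by rw [hxi]; exact (T.equivFin.symm i).2
  have hxS : ∀ i, x i ∈ S := fun i => hTS (hxT i)
  have hxe : ∀ y : T, x (T.equivFin y) = y := fun y => by rw [hxi, Equiv.symm_apply_apply]
  have hrange : Set.range x = ↑T := by
    ext p
    constructor
    · rintro ⟨i, rfl⟩
      exact hxT i
    · intro hp
      exact ⟨T.equivFin ⟨p, hp⟩, hxe ⟨p, hp⟩⟩
  have hsepx : ∀ i j : Fin T.card, i ≠ j → δ ≤ dist (x i) (x j) := fun i j hij =>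
    hsep _ (hxS i) _ (hxS j) fun h => hij (T.equivFin.symm.injective
      (Subtype.ext ((hxi i).symm.trans (h.trans (hxi j)))))
  -- a deep point whose re-rooted configuration misses `G` is not `η`-layered in the cluster
  have hD' : b * T.card ≤ (Nat.card {y : T // ¬ LayeredAt 2 2 η (Set.range x) (x (T.equivFin y))} : ℝ) := by
    refine hD.trans (Nat.cast_le.2 (natCard_mono fun y hy => ?_))
    intro hl
    refine hy.2 (hGL _ (isRootedHardCore_reroot hsep (hTS y.2)) ?_)
    refine (layeredAt_atoms_map_sub_iff 2 2 η _ (y : E3)).2 ?_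
    rw [atoms_count_restrict]
    rw [hxe y] at hl
    exact layeredAt_of_local hl (by rw [hrange]; exact hTS) (by rw [hrange]; exact hy.1)
  have hvi : Nat.card {y : T // ¬ LayeredAt 2 2 η (Set.range x) (x (T.equivFin y))} =
      Nat.card {i : Fin T.card // ¬ LayeredAt 2 2 η (Set.range x) (x i)} :=
    Nat.card_congr (Equiv.subtypeEquiv T.equivFin fun y => Iff.rfl)
  rw [hvi] at hD'
  -- `FiniteLayerRigidity` on the cluster
  have hN : M ≤ T.card := (le_max_left M 1).trans hTM
  have key := hM T.card x hN hsepx hE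
  have hT0 : (0 : ℝ) < T.card := by exact_mod_cast (le_max_right M 1).trans hTM
  have : b * T.card ≤ b / 2 * T.card := hD'.trans key
  nlinarith

/-! ## From `LayerFloor` to `FiniteLayerRigidity` -/

/-- **Registered sub-goal `lms_finiteLayerRigidity_of_layerFloor`**: the priced floor
`N e* + κ #{non-η-layered} ≤ 𝓔(x)` (`LayerFloor`, S⁺₆) gives `FiniteLayerRigidity` with `τ = κ b`,
`M = 0`. [folklore] -/
theorem lms_finiteLayerRigidity_of_layerFloor : (∀ δ : ℝ, 0 < δ → ∀ η : ℝ, 0 < η → ∃ κ : ℝ, 0 < κ ∧ ∀ (N : ℕ) (x : Fin N → E3), (∀ i j : Fin N, i ≠ j → δ ≤ dist (x i) (x j)) → (N : ℝ) * eStar + κ * (Nat.card {i : Fin N // ¬ LayeredAt 2 2 η (Set.range x) (x i)} : ℝ) ≤ interactionEnergy lennardJones x) → ∀ δ : ℝ, 0 < δ → ∀ η : ℝ, 0 < η → ∀ b : ℝ, 0 < b → ∃ τ : ℝ, 0 < τ ∧ ∃ M : ℕ, ∀ (N : ℕ) (x : Fin N → E3), M ≤ N → (∀ i j : Fin N, i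 ≠ j → δ ≤ dist (x i) (x j)) → interactionEnergy lennardJones x ≤ (N : ℝ) * eStar + τ * N → (Nat.card {i : Fin N // ¬ LayeredAt 2 2 η (Set.range x) (x i)} : ℝ) ≤ b * N := by
  intro hlf δ hδ η hη b hb
  obtain ⟨κ, hκ, h⟩ := hlf δ hδ η hη
  refine ⟨κ * b, mul_pos hκ hb, 0, fun N x _ hsep hE => ?_⟩
  have h1 := h N x hsep
  have h2 : κ * (Nat.card {i : Fin N // ¬ LayeredAt 2 2 η (Set.range x) (x i)} : ℝ) ≤ κ * (b * N) := by
    nlinarith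
  exact le_of_mul_le_mul_left h2 hκ

/-! ## From the two priced inequalities to `LayerFloor` -/

/-- **Finite-`N` bookkeeping** (the deterministic content of `SlackRigidityPricedFloorsApplication.core`,
freed from the cluster): from 13956 with constant `g` and the layered form of 13958 with constants
`(c, C)`, for every `δ`-separated `x : Fin N → ℝ³`,
`#{i not η-layered} ≤ A · (𝓔(x) − N e*)` with `A = (1 + (L + |C| K)/g)/c + 1/g`,
`K = (2·4/δ+1)³`, `L = (125/6)δ⁻⁶ + |e*|`. [folklore] -/
theorem card_nonLayered_le {δ η g c C : ℝ} (hδ : 0 < δ) (hg : 0 < g) (hc : 0 < c)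
    (h56 : ∀ (N : ℕ) (x : Fin N → E3), (∀ i j : Fin N, i ≠ j → δ ≤ dist (x i) (x j)) →
      (N : ℝ) * eStar + g * (Nat.card {i : Fin N // ¬ IsTwoShellGood (1 / 20) (47 / 50) 1 x i} : ℝ) ≤
        interactionEnergy lennardJones x)
    (h58 : ∀ (N : ℕ) (x : Fin N → E3), (∀ i j : Fin N, i ≠ j → δ ≤ dist (x i) (x j)) →
      ∀ Ω : Finset (Fin N), (∀ i ∈ Ω, IsTwoShellGood (1 / 20) (47 / 50) 1 x i) →
      c * (Nat.card {i : Fin N // i ∈ Ω ∧ ¬ LayeredAt 2 2 η (Set.range x) (x i)} : ℝ) -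
        C * (Nat.card {i : Fin N // i ∈ Ω ∧ ∃ j : Fin N, j ∉ Ω ∧ dist (x j) (x i) ≤ 4} : ℝ) ≤
        ∑ i ∈ Ω, ((1 / 2 : ℝ) * (∑ j ∈ Finset.univ.erase i, lennardJones (dist (x i) (x j))) -
          eStar))
    {N : ℕ} (x : Fin N → E3) (hsep : ∀ i j : Fin N, i ≠ j → δ ≤ dist (x i) (x j)) :
    (Nat.card {i : Fin N // ¬ LayeredAt 2 2 η (Set.range x) (x i)} : ℝ) ≤
      ((1 + ((125 / 6 * δ⁻¹ ^ 6 + |eStar|) + |C| * (2 * 4 / δ + 1) ^ 3) / g) / c + 1 / g) *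
        (interactionEnergy lennardJones x - N * eStar) := by
  classical
  -- abbreviations for the constants
  set K : ℝ := (2 * 4 / δ + 1) ^ 3 with hK
  set L : ℝ := 125 / 6 * δ⁻¹ ^ 6 + |eStar| with hL
  set X : ℝ := interactionEnergy lennardJones x - N * eStar with hX
  have hK0 : 0 ≤ K := by positivity
  have hL0 : 0 ≤ L := by positivity
  -- populations: good `Ω`, bad `B`
  obtain ⟨Ω, hΩ⟩ : ∃ Ω : Finset (Fin N),
      Ω = Finset.univ.filter fun i => IsTwoShellGood (1 / 20) (47 / 50) 1 x i := ⟨_, rfl⟩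
  obtain ⟨B, hB⟩ : ∃ B : Finset (Fin N),
      B = Finset.univ.filter fun i => ¬ IsTwoShellGood (1 / 20) (47 / 50) 1 x i := ⟨_, rfl⟩
  have hmemΩ : ∀ i, i ∈ Ω ↔ IsTwoShellGood (1 / 20) (47 / 50) 1 x i := fun i => by
    rw [hΩ]; exact Finset.mem_filter_univ i
  have hmemB : ∀ i, i ∈ B ↔ ¬ IsTwoShellGood (1 / 20) (47 / 50) 1 x i := fun i => by
    rw [hB]; exact Finset.mem_filter_univ i
  have hcardB : Nat.card {i : Fin N // ¬ IsTwoShellGood (1 / 20) (47 / 50) 1 x i} = B.card :=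
    Nat.subtype_card B hmemB
  -- the two priced inequalities
  have h1 := h56 N x hsep
  rw [hcardB] at h1
  have h2 := h58 N x hsep Ω fun i hi => (hmemΩ i).1 hi
  -- (i) few bad particles: `g #B ≤ X`
  have hnB : g * (B.card : ℝ) ≤ X := by rw [hX]; linarith
  -- (ii) the good particles carry little excess energy: `Σ_Ω ≤ X + L #B`
  have hsplit : (∑ i ∈ Ω, ((1 / 2 : ℝ) * (∑ j ∈ Finset.univ.erase i, lennardJones (dist (x i) (x j)))
        - eStar)) +
      ∑ i ∈ B, ((1 / 2 : ℝ) * (∑ j ∈ Finset.univ.erase i, lennardJones (dist (x i) (x j))) - eStar) =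
      X := by
    rw [hX, ← glue_sum_univ_half_site_sub x eStar, hΩ, hB]
    exact Finset.sum_filter_add_sum_filter_not _ _ _
  have hfloor : ∀ i ∈ B,
      -L ≤ (1 / 2 : ℝ) * (∑ j ∈ Finset.univ.erase i, lennardJones (dist (x i) (x j))) - eStar := by
    intro i _
    have h := half_site_ge x hδ hsep i
    rw [hL]
    linarith [le_abs_self eStar]
  have hSumB : (B.card : ℝ) * (-L) ≤
      ∑ i ∈ B, ((1 / 2 : ℝ) * (∑ j ∈ Finset.univ.erase i, lennardJones (dist (x i) (x j))) - eStar) := by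
    have := Finset.card_nsmul_le_sum B _ _ hfloor
    rwa [nsmul_eq_mul] at this
  have hSumΩ : ∑ i ∈ Ω, ((1 / 2 : ℝ) * (∑ j ∈ Finset.univ.erase i, lennardJones (dist (x i) (x j)))
      - eStar) ≤ X + L * B.card := by linarith
  -- (iii) the `4`-boundary of `Ω` is charged to the bad particles (fibre count)
  have hbd : (Nat.card {i : Fin N // i ∈ Ω ∧ ∃ j : Fin N, j ∉ Ω ∧ dist (x j) (x i) ≤ 4} : ℝ)
      ≤ K * B.card := by
    obtain ⟨SB, hSB⟩ : ∃ SB : Finset (Fin N), SB = Finset.univ.filter fun i =>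
        i ∈ Ω ∧ ∃ j : Fin N, j ∉ Ω ∧ dist (x j) (x i) ≤ 4 := ⟨_, rfl⟩
    have hmemSB : ∀ i, i ∈ SB ↔ (i ∈ Ω ∧ ∃ j : Fin N, j ∉ Ω ∧ dist (x j) (x i) ≤ 4) :=
      fun i => by rw [hSB]; exact Finset.mem_filter_univ i
    rw [Nat.subtype_card SB hmemSB, hK]
    refine stub_fibre δ 4 hδ (by norm_num) N x hsep SB B fun i hi => ?_
    obtain ⟨-, j, hj, hji⟩ := (hmemSB i).1 hi
    exact ⟨j, (hmemB j).2 fun hgj => hj ((hmemΩ j).2 hgj), (dist_comm (x i) (x j)).trans_le hji⟩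
  have hCn : C * (Nat.card {i : Fin N // i ∈ Ω ∧ ∃ j : Fin N, j ∉ Ω ∧
      dist (x j) (x i) ≤ 4} : ℝ) ≤ |C| * (K * B.card) :=
    (mul_le_mul_of_nonneg_right (le_abs_self C) (Nat.cast_nonneg _)).trans
      (mul_le_mul_of_nonneg_left hbd (abs_nonneg C))
  -- hence `c #{Ω, non-layered} ≤ X + (L + |C| K) #B`
  have hΩnl : c * (Nat.card {i : Fin N // i ∈ Ω ∧ ¬ LayeredAt 2 2 η (Set.range x) (x i)} : ℝ) ≤
      X + (L + |C| * K) * B.card := by nlinarith [h2, hCn, hSumΩ]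
  -- (iv) every non-layered particle is a non-layered good particle or a bad particle
  have hv : Nat.card {i : Fin N // ¬ LayeredAt 2 2 η (Set.range x) (x i)}
      ≤ Nat.card {i : Fin N // i ∈ Ω ∧ ¬ LayeredAt 2 2 η (Set.range x) (x i)} +
        Nat.card {i : Fin N // ¬ IsTwoShellGood (1 / 20) (47 / 50) 1 x i} := by
    refine natCard_le_add fun i hi => ?_
    by_cases hgi : IsTwoShellGood (1 / 20) (47 / 50) 1 x i
    · exact Or.inl ⟨(hmemΩ i).2 hgi, hi⟩
    · exact Or.inr hgi
  rw [hcardB] at hv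
  have hvR : (Nat.card {i : Fin N // ¬ LayeredAt 2 2 η (Set.range x) (x i)} : ℝ) ≤
      (Nat.card {i : Fin N // i ∈ Ω ∧ ¬ LayeredAt 2 2 η (Set.range x) (x i)} : ℝ) + B.card := by
    exact_mod_cast hv
  -- bookkeeping
  have hX0 : 0 ≤ X := le_trans (mul_nonneg hg.le (Nat.cast_nonneg _)) hnB
  have hBX : (B.card : ℝ) ≤ X / g := by
    rw [le_div_iff₀ hg]; linarith
  have hΩX : (Nat.card {i : Fin N // i ∈ Ω ∧ ¬ LayeredAt 2 2 η (Set.range x) (x i)} : ℝ) ≤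
      (X + (L + |C| * K) * (X / g)) / c := by
    rw [le_div_iff₀ hc]
    have e3 : (L + |C| * K) * (B.card : ℝ) ≤ (L + |C| * K) * (X / g) :=
      mul_le_mul_of_nonneg_left hBX (by positivity)
    linarith
  have hfin : (Nat.card {i : Fin N // ¬ LayeredAt 2 2 η (Set.range x) (x i)} : ℝ) ≤
      (X + (L + |C| * K) * (X / g)) / c + X / g := by linarith
  have e : (X + (L + |C| * K) * (X / g)) / c + X / g = ((1 + (L + |C| * K) / g) / c + 1 / g) * X := by
    field_simp
  rw [e] at hfin
  exact hfin

/-- **Registered sub-goal `lms_layerFloor_of_pricedInequalities`**: items 13956 `CoerciveTwoShellGap` and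
13958 `NearFieldConvexity` imply the selector-free priced floor `LayerFloor` (S⁺₆):
`N e* + κ #{i not η-layered at radius 2} ≤ 𝓔(x)` for every `δ`-separated `x`, with
`κ = 1/A`, `A` as in `card_nonLayered_le`. [folklore] -/
theorem lms_layerFloor_of_pricedInequalities : CoerciveTwoShellGap → NearFieldConvexity → ∀ δ : ℝ, 0 < δ → ∀ η : ℝ, 0 < η → ∃ κ : ℝ, 0 < κ ∧ ∀ (N : ℕ) (x : Fin N → E3), (∀ i j : Fin N, i ≠ j → δ ≤ dist (x i) (x j)) → (N : ℝ) * eStar + κ * (Nat.card {i : Fin N // ¬ LayeredAt 2 2 η (Set.range x) (x i)} : ℝ) ≤ interactionEnergy lennardJones x := by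
  intro h56 h58 δ hδ η hη
  obtain ⟨g, hg, h56'⟩ := coercive_eStar h56 hδ
  obtain ⟨c, hc, C, h58'⟩ := convexity_layered h58 hδ hη
  set A : ℝ := (1 + ((125 / 6 * δ⁻¹ ^ 6 + |eStar|) + |C| * (2 * 4 / δ + 1) ^ 3) / g) / c + 1 / g
    with hA
  have hA0 : 0 < A := by positivity
  refine ⟨1 / A, by positivity, fun N x hsep => ?_⟩
  have h := card_nonLayered_le hδ hg hc h56' h58' x hsep
  rw [← hA] at h
  have h' : 1 / A * (Nat.card {i : Fin N // ¬ LayeredAt 2 2 η (Set.range x) (x i)} : ℝ) ≤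
      1 / A * (A * (interactionEnergy lennardJones x - N * eStar)) :=
    mul_le_mul_of_nonneg_left h (by positivity)
  rw [← mul_assoc, one_div_mul_cancel hA0.ne', one_mul] at h'
  linarith

/-! ## The compositions with the six landed stubs of the line -/

/-- **S1 composed from `FiniteLayerRigidity`**: for a minimising point-stationary hard-core law, almost
surely EVERY point is `η`-layered (radii `2, 19/10`) for every `η > 0` (engine p138907 + sandwich
p139386 + the application above + the landed root-to-everywhere transfer). [folklore] -/
theorem floorsToLaw_of_finiteLayerRigidity
    (hflr : ∀ δ : ℝ, 0 < δ → ∀ η : ℝ, 0 < η → ∀ b : ℝ, 0 < b → ∃ τ : ℝ, 0 < τ ∧ ∃ M : ℕ,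
      ∀ (N : ℕ) (x : Fin N → E3), M ≤ N → (∀ i j : Fin N, i ≠ j → δ ≤ dist (x i) (x j)) →
      interactionEnergy lennardJones x ≤ (N : ℝ) * eStar + τ * N →
      (Nat.card {i : Fin N // ¬ LayeredAt 2 2 η (Set.range x) (x i)} : ℝ) ≤ b * N)
    {δ : ℝ} (hδ : 0 < δ) (P : Measure (Measure E3)) [hP : IsProbabilityMeasure P]
    (hlaw : IsMinimisingLaw δ P) :
    ∀ᵐ μ ∂P, ∀ y ∈ atoms μ, ∀ η : ℝ, 0 < η → LayeredAt 2 (19 / 10) η (atoms μ) y := by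
  have happ := lms_floorsApplication_of_finiteLayerRigidity hflr
  have hsel := SlackRigidityPricedFloorsSelection.stub_clusterSelection
  have hsand := SlackRigidityPricedFloorsSandwich.stub_layeredSandwich
  -- Step 1: for each `n`, a.s. the ROOT is `1/(n+1)`-layered with radii `(2, 19/10)`
  have hroot : ∀ n : ℕ, ∀ᵐ μ ∂P, LayeredAt 2 (19 / 10) (1 / ((n : ℝ) + 1)) (atoms μ) 0 := by
    intro n
    have hη : (0 : ℝ) < 1 / ((n : ℝ) + 1) := by positivity
    obtain ⟨G, hGm, hGup, hGlow⟩ := hsand δ (1 / ((n : ℝ) + 1)) hδ hη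
    have hPG : P Gᶜ = 0 :=
      happ δ hδ P hP hlaw (hsel δ hδ P hP hlaw) (1 / ((n : ℝ) + 1) / 2) (by positivity) G hGm
        (fun μ hc hl => hGlow μ hc hl)
    have hae : ∀ᵐ μ ∂P, μ ∈ G := by
      rw [ae_iff]
      simpa only [Set.compl_def] using hPG
    filter_upwards [hae, hlaw.1] with μ hμ hc
    exact hGup μ hc hμ
  -- Step 2: root ⇒ every point (mass transport), then all `η` by monotonicity
  have hall : ∀ᵐ μ ∂P, ∀ n : ℕ, LayeredAt 2 (19 / 10) (1 / ((n : ℝ) + 1)) (atoms μ) 0 :=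
    ae_all_iff.2 hroot
  have hlf : ∀ᵐ μ ∂P, ∀ n : ℕ, μ ((fun z : E3 => ⌊‖z‖⌋₊) ⁻¹' {n}) < ⊤ := by
    filter_upwards [hlaw.1] with μ hc n
    obtain ⟨S, -, hsep, rfl⟩ := hc
    exact PalmUnimodularRigidity.count_restrict_floorNorm_preimage_lt_top hδ hsep n
  have hev := PalmUnimodularRigidity.ae_forall_map_sub_of_ae hlaw.2.1 hlf hall
  filter_upwards [hev] with μ hμ y hy η hη
  obtain ⟨n, hn⟩ := exists_nat_one_div_lt hη
  have h1 := (layeredAt_atoms_map_sub_iff 2 (19 / 10) (1 / ((n : ℝ) + 1)) μ y).1 (hμ y hy n)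
  exact h1.mono le_rfl le_rfl hn.le

/-- **Registered sub-goal `lms_palmRigidity_of_finiteLayerRigidity`**: item 9224 `PalmRigidity` from
`FiniteLayerRigidity` alone (S1 above, exactification p139549, local-to-global p144649, Hägg selection
in mean p151115). [folklore] -/
theorem lms_palmRigidity_of_finiteLayerRigidity : (∀ δ : ℝ, 0 < δ → ∀ η : ℝ, 0 < η → ∀ b : ℝ, 0 < b → ∃ τ : ℝ, 0 < τ ∧ ∃ M : ℕ, ∀ (N : ℕ) (x : Fin N → E3), M ≤ N → (∀ i j : Fin N, i ≠ j → δ ≤ dist (x i) (x j)) → interactionEnergy lennardJones x ≤ (N : ℝ) * eStar + τ * N → (Nat.card {i : Fin N // ¬ LayeredAt 2 2 η (Set.range x) (x i)} : ℝ) ≤ b * N) → PalmRigidity := by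
  intro hflr δ hδ P hP hcore hstat hE
  have hlaw : IsMinimisingLaw δ P := ⟨hcore, hstat, hE⟩
  have hlay := floorsToLaw_of_finiteLayerRigidity hflr hδ P hlaw
  have hglobal : ∀ᵐ μ ∂P, GlobalLayered (atoms μ) := by
    filter_upwards [hlay, hlaw.1] with μ hμ hc
    obtain ⟨S, h0S, hsep, rfl⟩ := hc
    rw [atoms_count_restrict] at hμ ⊢
    exact SlackRigidityPricedFloorsReduction.exactLayeredGlobal_of
      SlackRigidityPricedFloorsExactify.stub_exactify SlackRigidityPricedFloorsGlobalize.stub_globalize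
      hδ S h0S hsep hμ
  exact SlackRigidityPricedFloorsFinal.stub_layeredMeanSelection δ hδ P hP hlaw hglobal

/-- **Registered sub-goal `lms_slackRigidity_of_finiteLayerRigidity`**: THIS crux from
`FiniteLayerRigidity` alone, through item 9224 and the landed closure
`EkelandSurgeryParityClosure.slackRigidity_of_palmRigidity` (p122051). [folklore] -/
theorem lms_slackRigidity_of_finiteLayerRigidity : (∀ δ : ℝ, 0 < δ → ∀ η : ℝ, 0 < η → ∀ b : ℝ, 0 < b → ∃ τ : ℝ, 0 < τ ∧ ∃ M : ℕ, ∀ (N : ℕ) (x : Fin N → E3), M ≤ N → (∀ i j : Fin N, i ≠ j → δ ≤ dist (x i) (x j)) → interactionEnergy lennardJones x ≤ (N : ℝ) * eStar + τ * N → (Nat.card {i : Fin N // ¬ LayeredAt 2 2 η (Set.range x) (x i)} : ℝ) ≤ b * N) → SlackRigidity :=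
  fun hflr => EkelandSurgeryParityClosure.slackRigidity_of_palmRigidity
    (lms_palmRigidity_of_finiteLayerRigidity hflr)

/-- **Registered sub-goal `lms_slackRigidity_of_layerFloor`**: THIS crux from the selector-free priced
floor `LayerFloor` (S⁺₆) alone. [folklore] -/
theorem lms_slackRigidity_of_layerFloor : (∀ δ : ℝ, 0 < δ → ∀ η : ℝ, 0 < η → ∃ κ : ℝ, 0 < κ ∧ ∀ (N : ℕ) (x : Fin N → E3), (∀ i j : Fin N, i ≠ j → δ ≤ dist (x i) (x j)) → (N : ℝ) * eStar + κ * (Nat.card {i : Fin N // ¬ LayeredAt 2 2 η (Set.range x) (x i)} : ℝ) ≤ interactionEnergy lennardJones x) → SlackRigidity :=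
  fun hlf => lms_slackRigidity_of_finiteLayerRigidity (lms_finiteLayerRigidity_of_layerFloor hlf)

/-- Consistency readback: the landed reduction from the two priced inequalities (p151540) factors
through `LayerFloor` and `FiniteLayerRigidity`. -/
example : CoerciveTwoShellGap → NearFieldConvexity → SlackRigidity :=
  fun h56 h58 => lms_slackRigidity_of_layerFloor (lms_layerFloor_of_pricedInequalities h56 h58)

end Summit.AtomisticToContinuum.Crystallization.Theorems.SlackRigidityPricedFloorsLayerFloor

end
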